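import Mathlib.RingTheory.LocalRing.MaximalIdeal.Basic
import Mathlib.RingTheory.Ideal.Maps
import HarnessLib

/-!
# [OURS · L1 W4.6, rungs (i)/(ii) — the dictionary, SCHEME HALF, brick 10] Changing the chart at a rational point:
# ring-level chart data for index `i` with a unit coordinate `τ̃_{j₀}` is chart data for index `j₀`

Cell res-hironaka (LADDER-RESOLUTION rung L, D-0089), slot W4.6, seat res-L1-s46-pv-2 (gen 2). Host: route
`WildCones`, crux `ClassicalRegimes` (stmt-ResolutionOfSingularities-16884), `--supports … --as helper`.

HONEST FRAMING. Everything here is OURS and is elementary algebra in a local ring. NOTHING here is a statement of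
H. Hironaka's manuscript [Hironaka2017]; no FACT-LIST premise. AI review is weaker than expert review.

## Statement (`exists_chartData_reindex`)

The ring-level chart data of bricks 5/6/8 (`FormalChart.exists_ringEquiv_completion_chart`,
`ChartPoint.exists_stalk_chartData`, `AtomGerm.exists_ringEquiv_transform_atom`) for a local homomorphism
`g : R → L` at a chart index `i`: quotients `e_j` with `g(c_j) = g(cᵢ) e_j`, `eᵢ = 1`, and lifts `τ̃_j` with
`𝔪_L = (g cᵢ) + (e_j − g τ̃_j : j ≠ i)`. If some coordinate `τ̃_{j₀}` (`j₀ ≠ i`) is a UNIT of `R` — the point lies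
in the chart `c_{j₀}` as well — then the same local ring carries chart data for the index `j₀`:
`e′_j = e_j e_{j₀}⁻¹` (`e_{j₀} ≡ τ̃_{j₀}` is a unit), `τ̃′_j = τ̃_j τ̃_{j₀}⁻¹` (`j ≠ i`), `τ̃′ᵢ = τ̃_{j₀}⁻¹`, with
`g(c_j) = g(c_{j₀}) e′_j`, `e′_{j₀} = 1` and `𝔪_L = (g c_{j₀}) + (e′_j − g τ̃′_j : j ≠ j₀)`. With brick 9's
`z`-chart exclusion (`AtomGerm.not_mem_maximalIdeal_transform_of_zChart`: at a point of the transform in the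
`z`-chart some `τ̃_j` is a unit) this puts every point of the transform of an atom into a `u`-chart, where brick 8
applies.

References: bricks 5–9 of this seat. [folklore]
-/

noncomputable section

-- single-problem summit: the doubled namespace component `ResolutionOfSingularities` is forced
set_option linter.dupNamespace false

open IsLocalRing

namespace Summit.ResolutionOfSingularities.ResolutionOfSingularities.Theorems

namespace CampaignW46.FormalChart

universe u

/-- In a local ring, an element congruent to a unit modulo the maximal ideal is a unit. [folklore] -/
theorem isUnit_of_sub_mem_maximalIdeal {L : Type u} [CommRing L] [IsLocalRing L] {x y : L} (hy : IsUnit y)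
    (h : x - y ∈ maximalIdeal L) : IsUnit x := by
  by_contra hx
  exact (IsLocalRing.mem_maximalIdeal _).1
    ((Submodule.sub_mem_iff_right _ ((IsLocalRing.mem_maximalIdeal _).2 hx)).1 h) hy

/-- [OURS · L1 W4.6 — DICTIONARY, SCHEME HALF, brick 10; NOT a statement of the manuscript] **Change of chart index
for ring-level chart data at a rational point.** See the module docstring. [folklore] -/
theorem exists_chartData_reindex {R L : Type u} [CommRing R] [IsLocalRing R] [CommRing L] [IsLocalRing L]
    (g : R →+* L) {σ : Type} [DecidableEq σ] (c : σ → R) (i : σ) (e : σ → L)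
    (he : ∀ j, g (c j) = g (c i) * e j) (hei : e i = 1) (τ : σ → R)
    (hgen : Ideal.span (Set.range fun j : σ => if j = i then g (c i) else e j - g (τ j)) = maximalIdeal L)
    (j₀ : σ) (hj₀ : j₀ ≠ i) (hτ₀ : IsUnit (τ j₀)) :
    ∃ (e' : σ → L) (τ' : σ → R), (∀ j, g (c j) = g (c j₀) * e' j) ∧ e' j₀ = 1 ∧
      Ideal.span (Set.range fun j : σ => if j = j₀ then g (c j₀) else e' j - g (τ' j)) = maximalIdeal L := by
  classical
  -- `u = e_{j₀}` is a unit, congruent to the unit `g τ_{j₀}`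
  have hgen₀ : e j₀ - g (τ j₀) ∈ maximalIdeal L := by
    rw [← hgen]; exact Ideal.subset_span ⟨j₀, by simp [hj₀]⟩
  have hu : IsUnit (e j₀) := isUnit_of_sub_mem_maximalIdeal (hτ₀.map g) hgen₀
  obtain ⟨w, hw⟩ := hτ₀.exists_right_inv
  set u := hu.unit with hu_def
  have huval : (u : L) = e j₀ := hu.unit_spec
  have hgw : g (τ j₀) * g w = 1 := by rw [← map_mul, hw, map_one]
  -- the new data
  refine ⟨fun j => e j * ↑u⁻¹, fun j => if j = i then w else τ j * w, fun j => ?_, ?_, ?_⟩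
  · -- quotients
    dsimp only
    rw [he j₀, he j, ← huval]
    have e1 : g (c i) * ↑u * (e j * ↑u⁻¹) = g (c i) * e j * ((u : L) * ↑u⁻¹) := by ring
    rw [e1, Units.mul_inv, mul_one]
  · -- `e′_{j₀} = 1`
    simp only [← huval, Units.mul_inv]
  · -- generators: both families generate the same ideal
    -- the key congruence `u⁻¹ − g w ∈ (u − g τ₀)`
    have hkey : (↑u⁻¹ : L) - g w = ↑u⁻¹ * g w * (g (τ j₀) - u) := by
      have : (↑u⁻¹ : L) * g w * (g (τ j₀) - ↑u) = ↑u⁻¹ * (g (τ j₀) * g w) - g w * (↑u⁻¹ * ↑u) := by ring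
      rw [this, hgw, Units.inv_mul, mul_one, mul_one]
    apply le_antisymm
    · -- new generators lie in `𝔪_L = span(old)`
      rw [Ideal.span_le]
      rintro _ ⟨j, rfl⟩
      rw [SetLike.mem_coe, ← hgen]
      have hv : g (c i) ∈ Ideal.span (Set.range fun j : σ => if j = i then g (c i) else e j - g (τ j)) :=
        Ideal.subset_span ⟨i, by simp⟩
      have hold : ∀ k, k ≠ i → e k - g (τ k) ∈
          Ideal.span (Set.range fun j : σ => if j = i then g (c i) else e j - g (τ j)) := fun k hk =>
        Ideal.subset_span ⟨k, by simp [hk]⟩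
      have hkey' : (↑u⁻¹ : L) - g w ∈
          Ideal.span (Set.range fun j : σ => if j = i then g (c i) else e j - g (τ j)) := by
        rw [hkey, show g (τ j₀) - (u : L) = -(e j₀ - g (τ j₀)) by rw [huval]; ring]
        exact Ideal.mul_mem_left _ _ ((Ideal.neg_mem_iff _).2 (hold j₀ hj₀))
      by_cases hj : j = j₀
      · simp only [hj, if_true]
        rw [he j₀]
        exact Ideal.mul_mem_right _ _ hv
      · simp only [if_neg hj]
        by_cases hji : j = i
        · simp only [hji, if_true, hei, one_mul]
          exact hkey'
        · simp only [if_neg hji, map_mul]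
          have e1 : e j * ↑u⁻¹ - g (τ j) * g w = ↑u⁻¹ * (e j - g (τ j)) + g (τ j) * (↑u⁻¹ - g w) := by ring
          rw [e1]
          exact Ideal.add_mem _ (Ideal.mul_mem_left _ _ (hold j hji)) (Ideal.mul_mem_left _ _ hkey')
    · -- old generators lie in `span(new)`
      rw [← hgen, Ideal.span_le]
      rintro _ ⟨j, rfl⟩
      rw [SetLike.mem_coe]
      set N := Ideal.span (Set.range fun j : σ => if j = j₀ then g (c j₀) else e j * ↑u⁻¹ - g (if j = i then w else τ j * w))
        with hN
      have hv' : g (c j₀) ∈ N := Ideal.subset_span ⟨j₀, by simp⟩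
      have hnew : ∀ k, k ≠ j₀ → e k * ↑u⁻¹ - g (if k = i then w else τ k * w) ∈ N := fun k hk =>
        Ideal.subset_span ⟨k, by simp [hk]⟩
      have hkeyN : (↑u⁻¹ : L) - g w ∈ N := by
        have := hnew i (Ne.symm hj₀)
        simpa only [if_true, hei, one_mul] using this
      have hu₀ : (u : L) - g (τ j₀) ∈ N := by
        have e1 : (u : L) - g (τ j₀) = -((u : L) * g (τ j₀)) * (↑u⁻¹ - g w) := by
          have : -((u : L) * g (τ j₀)) * (↑u⁻¹ - g w) = -(g (τ j₀) * (↑u * ↑u⁻¹)) + ↑u * (g (τ j₀) * g w) := by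
            ring
          rw [this, Units.mul_inv, hgw]; ring
        rw [e1]
        exact Ideal.mul_mem_left _ _ hkeyN
      by_cases hji : j = i
      · simp only [hji, if_true]
        have e1 : g (c i) = g (c j₀) * ↑u⁻¹ := by
          rw [he j₀, ← huval, mul_assoc, Units.mul_inv, mul_one]
        rw [e1]
        exact Ideal.mul_mem_right _ _ hv'
      · simp only [if_neg hji]
        by_cases hj : j = j₀
        · subst hj
          rw [← huval]
          exact hu₀
        · have h1 := hnew j hj
          simp only [if_neg hji, map_mul] at h1
          have e1 : e j - g (τ j) = (u : L) * (e j * ↑u⁻¹ - g (τ j) * g w) + g (τ j) * g w * ((u : L) - g (τ j₀)) := by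
            have : (u : L) * (e j * ↑u⁻¹ - g (τ j) * g w) + g (τ j) * g w * (↑u - g (τ j₀)) =
                e j * (↑u * ↑u⁻¹) - g (τ j) * (g (τ j₀) * g w) := by ring
            rw [this, Units.mul_inv, hgw]; ring
          rw [e1]
          exact Ideal.add_mem _ (Ideal.mul_mem_left _ _ h1) (Ideal.mul_mem_left _ _ hu₀)

end CampaignW46.FormalChart

end Summit.ResolutionOfSingularities.ResolutionOfSingularities.Theorems

end
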